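import Summits.BirchSwinnertonDyer.BirchSwinnertonDyer.Theorems.AdditiveBranchIMCGordTwoRankOneShaAnUnit
import HarnessLib

/-!
# Route `AdditiveBranchIMC` (rung K1), crux `GordTwoRankOne` (item 19358): ONE booking door per key for the
# X3 (rational `p`-isogeny) ∩ (G-ord, `e = 2`) ∩ rank-one UNIT-window rows at EVERY odd `p`, and its isogeny-class form
# — the doors of the X3-UNIT r1 packet (cell `bsd-addord`, seat `bsd-addord-k1-c3` gen 9, D-0074 row B2)

HONEST FRAMING. THEOREMS ONLY: no definition, no named fact, no `sorry`, nothing booked; BSD is not proved by any of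
this; crux `GordTwoRankOne` stays OPEN at class level (Λ-adic children 19497/19498, certificate child 19499). This
file re-packages gen 5's three per-parity doors
`classX3Gord_bsdp_rankOne{_three,_odd,}_of_wuthrichHalf_of_branchCoeffOneNeZero_of_shaAnUnit` (file `…ShaAnUnit`, §2)
as ONE declaration valid at every odd prime (the parity / `p = 3` dispatch is done inside), in the two datum currencies
used by the booking desks (`ord_p s ≤ 0`, and the EXACT-`#Ш_an` shape `padicValRat p q = 0`), plus the ISOGENY-CLASS
form (Cassels transport, `N10.bsdp_of_isIsogenous_of_bsdp`) and the `hArt`-discharged variants — the X3 twin of gen 6's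
`…BookingDoors.lean`. It is the consumer named per key by the X3-UNIT r1 booking tables
(`HOME/k1-c3/hybrid-g9/x3unit/`: 2 123 (class, p) keys, 2 043 at `p = 3`, outside the branch-parity census; NO line datum,
NO Case-1 member, NO parity / non-anomalous / degeneracy clause, NO Tamagawa or torsion hypothesis).

Per key the inputs are: Wuthrich's half-eigenspace reading `hW16`, the cite-only facts `hCyc hArt h73 hWald hmod hmodD
hmodN hGZK` (+ `hCassels` for the class form), the decidable data `ClassX3Gord W p`, `e = 2`, `p ≠ 2`, `r_an = 1`, the
two-engine certificate `A′ ≠ 0` (`BranchCoeffOneNeZeroAt W p`) and the datum `#Ш(E)_an = s`, `ord_p s ≤ 0`.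
References: [Wuthrich2014] Thm. 16; [Delbourgo2002] Thm. (B); [Disegni2017] Thm. A/B; [MazurTateTeitelbaum1986Invent]
§I.13–I.14; [MilneADT2006] Thm. I.7.3; [Miller2011LMS] Def. 1.1; HOME/k1-c3/CERT-ROADS-19358-g9.md.
-/

set_option autoImplicit false
set_option linter.dupNamespace false
noncomputable section
open scoped Classical MatrixGroups ModularForm NumberField
open CongruenceSubgroup WeierstrassCurve NumberField IsDedekindDomain Field
  Literature.NumberTheory.EllipticCurves Literature.NumberTheory.EllipticCurves.ModularForms
  Literature.NumberTheory.EllipticCurves.GreenbergVatsal2000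
  Literature.NumberTheory.EllipticCurves.Rank1Residual
  Literature.NumberTheory.EllipticCurves.Rank1Residual.Typed
  Literature.NumberTheory.EllipticCurves.Delbourgo2002
  Literature.NumberTheory.EllipticCurves.Disegni2017
  Literature.NumberTheory.GaloisRepresentations
  Summit.BirchSwinnertonDyer.Rank1Residual.AdditivePotMult
  Summit.BirchSwinnertonDyer.Rank1Residual.Additive
  Summit.BirchSwinnertonDyer.BirchSwinnertonDyer.Theses.AdditiveBranchIMC

namespace Summit.BirchSwinnertonDyer.BirchSwinnertonDyer.Theorems.AdditiveBranchIMCGordTwoRankOne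

/-- **X3♯(G-ord) ∩ `I₀*` (`E[p]` reducible, `e = 2`), `r_an(E) = 1`, ANY odd `p` (anomalous or not, Case-1 member or
not, degenerate at `3` or not): `BSD(E,p)` from Wuthrich's half-eigenspace reading `hW16`, the cite-only facts
`hCyc hArt h73 hWald hmod hmodD hmodN hGZK`, the two-engine certificate `A′ ≠ 0` (`BranchCoeffOneNeZeroAt W p`) and the
datum `#Ш(E)_an = s`, `ord_p s ≤ 0`.** One declaration for every odd prime: `p = 3` ↦ gen 5's `…_three_…` door,
`p ≡ 1 (mod 4)` ↦ the even door, `p ≡ 3 (mod 4)`, `p ≥ 5` ↦ the odd door. Nothing booked.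
[cite: Wuthrich2014, Thm. 16 (p. 397)] [cite: Delbourgo2002, Theorem (B) (p. 40)]
[cite: Disegni2017, Theorem A/B (arXiv v3 PDF 7–9)] [cite: MazurTateTeitelbaum1986Invent, §I.13–I.14]
[cite: Miller2011LMS, Def. 1.1] -/
theorem classX3Gord_bsdp_rankOne_anyOdd_of_wuthrichHalf_of_branchCoeffOneNeZero_of_shaAnUnit
    (hW16 : Wuthrich2014.thm16_halfEigenCharIdeal_dvd_cyclotomicPrime)
    (hCyc : delbourgoDatum_cycLineGrossZagier)
    (hArt : rankinSelbergEulerProductHecke_baseChangeDirichlet_eq) (h73 : GrossZagier1986_thm_I_7_3)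
    (hWald : waldspurger_exists_heegnerField_twist_ne_zero)
    (hmod : hasEntireLFunction_rat) (hmodD : nonempty_modularParametrizationData)
    (hmodN : exists_isNewformOf) (hGZK : rank_eq_analyticRank_of_analyticRank_le_one)
    {W : WeierstrassCurve ℚ} [W.IsElliptic] [W.IsGloballyMinimal] {p : ℕ} [Fact p.Prime]
    (hp2 : p ≠ 2) (hX : ClassX3Gord W p) (he : semistabilityIndex W p = 2)
    (hr : W.analyticRank = 1) (hne : BranchCoeffOneNeZeroAt W p)
    {s : ℚ} (hs : shaAn W = (s : ℂ)) (hsv : padicValRat p s ≤ 0) : BSDp W p := by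
  by_cases hp3 : p = 3
  · subst hp3
    exact classX3Gord_bsdp_rankOne_three_of_wuthrichHalf_of_branchCoeffOneNeZero_of_shaAnUnit hW16 hCyc hArt h73
      hWald hmod hmodD hmodN hGZK hX hr hne hs hsv
  · have hp5 : 5 ≤ p := (Fact.out : p.Prime).five_le_of_ne_two_of_ne_three hp2 hp3
    have hodd : p % 4 = 1 ∨ p % 4 = 3 := by
      obtain ⟨k, hk⟩ := (Fact.out : p.Prime).odd_of_ne_two hp2
      omega
    rcases hodd with h1 | h3
    · exact classX3Gord_bsdp_rankOne_of_wuthrichHalf_of_branchCoeffOneNeZero_of_shaAnUnit hW16 hCyc hArt h73 hWald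
        hmod hmodD hmodN hGZK hX he h1 hr hne hs hsv
    · exact classX3Gord_bsdp_rankOne_odd_of_wuthrichHalf_of_branchCoeffOneNeZero_of_shaAnUnit hW16 hCyc hArt h73
        hWald hmod hmodD hmodN hGZK hX he h3 hp5 hr hne hs hsv

/-- **The same door in the EXACT-`#Ш_an` currency** of the D3X4R1 / SHAUNIT booking doors: datum `#Ш(E)_an = q ∈ ℚ` with
`padicValRat p q = 0` (Cremona value, `p ∤ #Ш_an`). [cite: Wuthrich2014, Thm. 16 (p. 397)]
[cite: Delbourgo2002, Theorem (B) (p. 40)] [cite: Disegni2017, Theorem A/B] [cite: Miller2011LMS, §1 and Def. 1.1] -/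
theorem classX3Gord_bsdp_rankOne_anyOdd_of_wuthrichHalf_of_branchCoeffOneNeZero_of_shaAnExact
    (hW16 : Wuthrich2014.thm16_halfEigenCharIdeal_dvd_cyclotomicPrime)
    (hCyc : delbourgoDatum_cycLineGrossZagier)
    (hArt : rankinSelbergEulerProductHecke_baseChangeDirichlet_eq) (h73 : GrossZagier1986_thm_I_7_3)
    (hWald : waldspurger_exists_heegnerField_twist_ne_zero)
    (hmod : hasEntireLFunction_rat) (hmodD : nonempty_modularParametrizationData)
    (hmodN : exists_isNewformOf) (hGZK : rank_eq_analyticRank_of_analyticRank_le_one)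
    {W : WeierstrassCurve ℚ} [W.IsElliptic] [W.IsGloballyMinimal] {p : ℕ} [Fact p.Prime]
    (hp2 : p ≠ 2) (hX : ClassX3Gord W p) (he : semistabilityIndex W p = 2)
    (hr : W.analyticRank = 1) (hne : BranchCoeffOneNeZeroAt W p)
    {q : ℚ} (hq : shaAn W = (q : ℂ)) (hv : padicValRat p q = 0) : BSDp W p :=
  classX3Gord_bsdp_rankOne_anyOdd_of_wuthrichHalf_of_branchCoeffOneNeZero_of_shaAnUnit hW16 hCyc hArt h73 hWald hmod
    hmodD hmodN hGZK hp2 hX he hr hne hq hv.le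

/-- **ISOGENY-CLASS FORM (the booking unit is the class).** For every globally minimal `E'` that is `ℚ`-isogenous to a
member `E` of the class carrying the door's inputs (X3♯(G-ord) ∩ `I₀*` at the odd prime `p`, `r_an = 1`, `A′ ≠ 0`,
`#Ш(E)_an = s` with `ord_p s ≤ 0` — on the X3-UNIT tables `E` is the UNIT member of the class), `BSD(E',p)` holds —
Cassels' isogeny invariance of the BSD quotient (`hCassels`, via the cell's `N10.bsdp_of_isIsogenous_of_bsdp`; the
analytic rank is an isogeny invariant unconditionally). [cite: MilneADT2006, Thm. I.7.3 and Remark I.7.4]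
[cite: Wuthrich2014, Thm. 16 (p. 397)] [cite: Delbourgo2002, Theorem (B) (p. 40)] [cite: Disegni2017, Theorem A/B]
[cite: Miller2011LMS, §1 and Def. 1.1] -/
theorem isogenous_bsdp_rankOne_anyOdd_of_classX3Gord_of_wuthrichHalf_of_branchCoeffOneNeZero_of_shaAnUnit
    (hCassels : bsdRHS_eq_of_isIsogenous)
    (hW16 : Wuthrich2014.thm16_halfEigenCharIdeal_dvd_cyclotomicPrime)
    (hCyc : delbourgoDatum_cycLineGrossZagier)
    (hArt : rankinSelbergEulerProductHecke_baseChangeDirichlet_eq) (h73 : GrossZagier1986_thm_I_7_3)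
    (hWald : waldspurger_exists_heegnerField_twist_ne_zero)
    (hmod : hasEntireLFunction_rat) (hmodD : nonempty_modularParametrizationData)
    (hmodN : exists_isNewformOf) (hGZK : rank_eq_analyticRank_of_analyticRank_le_one)
    {W W' : WeierstrassCurve ℚ} [W.IsElliptic] [W.IsGloballyMinimal] [W'.IsElliptic] [W'.IsGloballyMinimal]
    {p : ℕ} [Fact p.Prime] (hiso : IsIsogenous W' W)
    (hp2 : p ≠ 2) (hX : ClassX3Gord W p) (he : semistabilityIndex W p = 2)
    (hr : W.analyticRank = 1) (hne : BranchCoeffOneNeZeroAt W p)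
    {s : ℚ} (hs : shaAn W = (s : ℂ)) (hsv : padicValRat p s ≤ 0) : BSDp W' p := by
  have hr' : W'.analyticRank ≤ 1 := by rw [analyticRank_eq_of_isIsogenous' hiso, hr]
  exact N10.bsdp_of_isIsogenous_of_bsdp p hCassels hGZK hmod hiso hr'
    (classX3Gord_bsdp_rankOne_anyOdd_of_wuthrichHalf_of_branchCoeffOneNeZero_of_shaAnUnit hW16 hCyc hArt h73 hWald
      hmod hmodD hmodN hGZK hp2 hX he hr hne hs hsv)

/-! ### §2 The same doors with the binder `hArt` DISCHARGED

The Artin-formalism input `rankinSelbergEulerProductHecke_baseChangeDirichlet_eq` (`hArt`) is a tree THEOREM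
(`…_holds`, `Literature/NumberTheory/EllipticCurves/RankinSelbergBaseChangeDirichlet.lean`); the doors below feed it by
name, so a booking row displays one binder fewer: `hW16` + cite-only `hCyc h73 hWald hmod hmodD hmodN hGZK` (+ `hCassels`
for the class form) + `A′ ≠ 0` + the datum. -/

/-- **ONE door per key, every odd `p`, EXACT-`#Ш_an` currency, `hArt` discharged**: X3♯(G-ord) ∩ `I₀*`, `r_an = 1`:
`BSD(E,p)` ⟸ `hW16` + `hCyc h73 hWald hmod hmodD hmodN hGZK` + `A′ ≠ 0` + (`#Ш(E)_an = q`, `padicValRat p q = 0`).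
[cite: Wuthrich2014, Thm. 16 (p. 397)] [cite: Delbourgo2002, Theorem (B) (p. 40)] [cite: Disegni2017, Theorem A/B]
[cite: Gross2004, §3 (p. 40) and §13 (p. 49)] [cite: Miller2011LMS, §1 and Def. 1.1] -/
theorem classX3Gord_bsdp_rankOne_anyOdd_of_wuthrichHalf_of_branchCoeffOneNeZero_of_shaAnExact_artFree
    (hW16 : Wuthrich2014.thm16_halfEigenCharIdeal_dvd_cyclotomicPrime)
    (hCyc : delbourgoDatum_cycLineGrossZagier) (h73 : GrossZagier1986_thm_I_7_3)
    (hWald : waldspurger_exists_heegnerField_twist_ne_zero)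
    (hmod : hasEntireLFunction_rat) (hmodD : nonempty_modularParametrizationData)
    (hmodN : exists_isNewformOf) (hGZK : rank_eq_analyticRank_of_analyticRank_le_one)
    {W : WeierstrassCurve ℚ} [W.IsElliptic] [W.IsGloballyMinimal] {p : ℕ} [Fact p.Prime]
    (hp2 : p ≠ 2) (hX : ClassX3Gord W p) (he : semistabilityIndex W p = 2)
    (hr : W.analyticRank = 1) (hne : BranchCoeffOneNeZeroAt W p)
    {q : ℚ} (hq : shaAn W = (q : ℂ)) (hv : padicValRat p q = 0) : BSDp W p :=
  classX3Gord_bsdp_rankOne_anyOdd_of_wuthrichHalf_of_branchCoeffOneNeZero_of_shaAnUnit hW16 hCyc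
    rankinSelbergEulerProductHecke_baseChangeDirichlet_eq_holds h73 hWald hmod hmodD hmodN hGZK hp2 hX he hr hne hq
    hv.le

/-- **ISOGENY-CLASS form, EXACT currency, `hArt` discharged**: for every globally minimal `E'` `ℚ`-isogenous to the
door's member `E` (the unit member of the class), `BSD(E',p)` (Cassels `hCassels`). This is the shape a class booking
names: one member `E` with the decidable data + `A′ ≠ 0` + `p ∤ #Ш(E)_an`, every other member by transport.
[cite: MilneADT2006, Thm. I.7.3 and Remark I.7.4] [cite: Wuthrich2014, Thm. 16 (p. 397)]
[cite: Delbourgo2002, Theorem (B) (p. 40)] [cite: Disegni2017, Theorem A/B] [cite: Miller2011LMS, §1 and Def. 1.1] -/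
theorem isogenous_bsdp_rankOne_anyOdd_of_classX3Gord_of_wuthrichHalf_of_branchCoeffOneNeZero_of_shaAnExact_artFree
    (hCassels : bsdRHS_eq_of_isIsogenous)
    (hW16 : Wuthrich2014.thm16_halfEigenCharIdeal_dvd_cyclotomicPrime)
    (hCyc : delbourgoDatum_cycLineGrossZagier) (h73 : GrossZagier1986_thm_I_7_3)
    (hWald : waldspurger_exists_heegnerField_twist_ne_zero)
    (hmod : hasEntireLFunction_rat) (hmodD : nonempty_modularParametrizationData)
    (hmodN : exists_isNewformOf) (hGZK : rank_eq_analyticRank_of_analyticRank_le_one)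
    {W W' : WeierstrassCurve ℚ} [W.IsElliptic] [W.IsGloballyMinimal] [W'.IsElliptic] [W'.IsGloballyMinimal]
    {p : ℕ} [Fact p.Prime] (hiso : IsIsogenous W' W)
    (hp2 : p ≠ 2) (hX : ClassX3Gord W p) (he : semistabilityIndex W p = 2)
    (hr : W.analyticRank = 1) (hne : BranchCoeffOneNeZeroAt W p)
    {q : ℚ} (hq : shaAn W = (q : ℂ)) (hv : padicValRat p q = 0) : BSDp W' p :=
  isogenous_bsdp_rankOne_anyOdd_of_classX3Gord_of_wuthrichHalf_of_branchCoeffOneNeZero_of_shaAnUnit hCassels hW16 hCyc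
    rankinSelbergEulerProductHecke_baseChangeDirichlet_eq_holds h73 hWald hmod hmodD hmodN hGZK hiso hp2 hX he hr hne hq
    hv.le

end Summit.BirchSwinnertonDyer.BirchSwinnertonDyer.Theorems.AdditiveBranchIMCGordTwoRankOne

end
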